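import Summits.HodgeConjecture.HodgeConjecture.Theorems.NoetherLefschetzOneUpSummitGrantedFourfoldsCodimTwoReach
import Literature.AlgebraicGeometry.HodgeTheory.SupportedHodgeClassesAlgebraic
import HarnessLib

/-!
# Crux `SummitGrantedFourfolds` (stmt-HodgeConjecture-14600), line `Sketch` — THE LADDER BY CONIVEAU DEFECT:
# the rungs `≤ k` decide, in EVERY dimension, exactly the rational Hodge classes of coniveau defect `≤ k`;
# granted HC(4;2,2) (`k = 2`): classes of codimension `p + 2` supported in codimension `≥ p` (helpers, `--supports`)

The crux `SummitGrantedFourfolds` (`HC(4;2,2) → HodgeConjecture`) is in content the dimension ladder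
"middle degree `(m,m)` of `2m`-folds for every `m ≥ 3`". This file makes precise, uniformly in `k`,
what the rungs `≤ k` of that ladder buy in every dimension — the WINDOW CRITERION of the crux's idea
cards `fourfold-window-transport` (4) / `fourfold-double-incidence` / `chow-small-end` (3) in support
form — all sorry-free, no named fact as hypothesis:

* `hodge_codim_le_of_dim_le` — **HC in codimension `≤ k` in EVERY dimension follows from HC in
  codimension `≤ k` in dimensions `≤ 2k`** (the codimension-truncated pencil step
  `stub_pencilStepCodim`, p156883, by induction on the dimension);
  `hodge_codim_le_of_levelsLE` — hence from the middle rungs `(2m; m, m)`, `m ≤ k`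
  (`hodgeBelowDim_of_levelsBelow`).
* `mem_algebraicClasses_of_supportedClasses_of_codim_le` — **given HC in codimension `≤ k` in every
  dimension, on every smooth projective `X` every rational `(r+k, r+k)`-class supported in codimension
  `≥ r` (coniveau defect `≤ k`) is algebraic**: desingularise the components of the support
  (`exists_family_iUnion_range_eq_of_isClosed`, Hironaka in the tree's proved form), Deligne descent +
  lifting of Hodge classes (`Voisin2025_hodgeClass_lift_complexGysin.mem_iSup_map_of_restrictCompl_eq_zero`,
  both facts discharged in the tree) writes `c = Σⱼ (gⱼ)_* βⱼ` with `βⱼ` rational Hodge of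
  codimension `≤ k` on the `Ỹⱼ`, and Gysin images of algebraic classes are algebraic. The slice
  `k = 1` is Voisin 2013 Lemma 2.1 (in tree: `supportedHodgeClass_algebraic_of_facts`, from Lefschetz
  `(1,1)`); the slice `k = 2` is NEW and is exactly what HC(4;2,2) decides:
* `mem_algebraicClasses_of_supportedClasses_of_hc42` — **granted HC(4;2,2), on every smooth projective
  complex variety every rational Hodge class of codimension `r + 2` supported in codimension `≥ r` is
  algebraic**; in the middle degree (`middle_mem_algebraicClasses_of_coniveau_of_hc42`): on a
  `2(m+2)`-fold, rational `(m+2, m+2)`-classes of coniveau `≥ m` — sixfolds: coniveau `≥ 1`;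
  eightfolds: coniveau `≥ 2`; … — with NO lower rung and no induction (the cards' "windows").
  What stays open of the crux is therefore, rung by rung, the coniveau-defect `≥ 3` part; at the
  first rung `(6;3,3)` that is "rational `(3,3)`-classes have coniveau `≥ 1`" (`stub_heartConiveauOne`).

## References

* [Voisin2013GHCBloch] C. Voisin, Lemma 2.1 and its proof.
* [DeligneHodgeIII1974] P. Deligne, Théorie de Hodge III, Cor. 8.2.8.
* [Voisin2025] C. Voisin, J. Open Math. Probl. 1 (2025), Cor. 2.12, Thm. 4.4, Cor. 4.5.
* [Thomas2005Nodes] R. P. Thomas, Nodes and the Hodge conjecture, §2 Prop. 2.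
* [DecataldoMigliorini2009] M. A. de Cataldo, L. Migliorini, §4 Prop. 4.5.
* [BrosnanFangNiePearlstein2009] P. Brosnan, H. Fang, Z. Nie, G. Pearlstein, §6 Lemma 48.
* [Kollar2007] J. Kollár, Lectures on Resolution of Singularities, Thm. 3.27.
-/

-- `Summit.HodgeConjecture.HodgeConjecture.Theorems` is the mandated namespace (single-problem summit),
-- flagged by `linter.dupNamespace`; the lakefile turns the linter off tree-wide, restated here.
set_option linter.dupNamespace false

noncomputable section

namespace Summit.HodgeConjecture.HodgeConjecture.Theorems

open CategoryTheory AlgebraicGeometry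
open Literature.AlgebraicGeometry Literature.AlgebraicGeometry.Motives
  Literature.AlgebraicGeometry.HodgeTheory Literature.AlgebraicTopology.SingularHomology
open RegimeSplit

/-! ### HC in codimension `≤ k` everywhere, from dimensions `≤ 2k` -/

/-- **The Hodge conjecture in codimension `≤ k` in every dimension follows from the Hodge
conjecture in codimension `≤ k` in dimensions `≤ 2k`**: strong induction on the dimension `n`; for
`n = m + 1 > 2k` the codimension-truncated pencil step `stub_pencilStepCodim` applies (`2p ≤ 2k ≤ m`)
with the induction hypothesis on the `m`-folds. [cite: Thomas2005Nodes, §2 Prop. 2]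
[cite: DecataldoMigliorini2009, §4 Prop. 4.5] -/
theorem hodge_codim_le_of_dim_le (k : ℕ)
    (hk : ∀ ⦃n : ℕ⦄ ⦃X : SchemeOver ℂ⦄, n ≤ 2 * k → IsSmoothProjective n X → ∀ p : ℕ, p ≤ k →
      ∀ c : complexBetti X (2 * p), IsRationalClass c → IsOfHodgeType n X (2 * p) p p c →
        c ∈ algebraicClasses X p) :
    ∀ (n : ℕ) ⦃X : SchemeOver ℂ⦄, IsSmoothProjective n X → ∀ p : ℕ, p ≤ k →
      ∀ c : complexBetti X (2 * p), IsRationalClass c → IsOfHodgeType n X (2 * p) p p c →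
        c ∈ algebraicClasses X p := by
  intro n
  induction n using Nat.strong_induction_on with
  | _ n ihn =>
  intro X hX p hp c hc hh
  rcases Nat.lt_or_ge (2 * k) n with hlt | hge
  · obtain ⟨m, rfl⟩ : ∃ m, n = m + 1 := ⟨n - 1, by omega⟩
    exact stub_pencilStepCodim hX p
      (fun Y hY q hq c' hc' hh' ↦ ihn m (lt_add_one m) hY q (hq.trans hp) c' hc' hh') (by omega) c hc hh
  · exact hk hge hX p hp c hc hh

/-- **The middle rungs `≤ k` give the Hodge conjecture in codimension `≤ k` in every dimension**:
the rungs `(2m; m, m)`, `m ≤ k`, give HC in all dimensions `≤ 2k + 1`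
(`hodgeBelowDim_of_levelsBelow` at `k + 1`, BFNP Lemma 48 truncated), in particular in dimensions
`≤ 2k`, and `hodge_codim_le_of_dim_le` spreads codimension `≤ k` to every dimension.
[cite: BrosnanFangNiePearlstein2009, §6 Lemma 48] [cite: Thomas2005Nodes, §2 Prop. 2] -/
theorem hodge_codim_le_of_levelsLE (k : ℕ)
    (hlev : ∀ m : ℕ, m ≤ k → ∀ ⦃X : SchemeOver ℂ⦄, IsSmoothProjective (2 * m) X →
      ∀ c : complexBetti X (2 * m), IsRationalClass c → IsOfHodgeType (2 * m) X (2 * m) m m c →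
        c ∈ algebraicClasses X m) :
    ∀ (n : ℕ) ⦃X : SchemeOver ℂ⦄, IsSmoothProjective n X → ∀ p : ℕ, p ≤ k →
      ∀ c : complexBetti X (2 * p), IsRationalClass c → IsOfHodgeType n X (2 * p) p p c →
        c ∈ algebraicClasses X p := by
  have hB : HodgeBelowDim (2 * (k + 1)) :=
    hodgeBelowDim_of_levelsBelow (m := k + 1) fun m' hm' ↦ hlev m' (by omega)
  exact hodge_codim_le_of_dim_le k fun n X hn hX p _ c hc hh ↦ hB (by omega) hX p c hc hh

/-- **The rungs `≤ k` of the ladder ARE the Hodge conjecture in codimension `≤ k` in every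
dimension** (`hodge_codim_le_of_levelsLE` and the specialisation `n = 2m`, `p = m ≤ k`).
[cite: BrosnanFangNiePearlstein2009, §6 Lemma 48] [cite: Thomas2005Nodes, §2 Prop. 2] -/
theorem levelsLE_iff_hodge_codim_le (k : ℕ) :
    (∀ m : ℕ, m ≤ k → ∀ ⦃X : SchemeOver ℂ⦄, IsSmoothProjective (2 * m) X →
      ∀ c : complexBetti X (2 * m), IsRationalClass c → IsOfHodgeType (2 * m) X (2 * m) m m c →
        c ∈ algebraicClasses X m) ↔
    ∀ (n : ℕ) ⦃X : SchemeOver ℂ⦄, IsSmoothProjective n X → ∀ p : ℕ, p ≤ k →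
      ∀ c : complexBetti X (2 * p), IsRationalClass c → IsOfHodgeType n X (2 * p) p p c →
        c ∈ algebraicClasses X p :=
  ⟨hodge_codim_le_of_levelsLE k, fun h m hm _ hX c hc hh ↦ h (2 * m) hX m hm c hc hh⟩

/-- **The rungs `≤ k` of the ladder ARE the Hodge conjecture in all dimensions `≤ 2k + 1`**
(`hodgeBelowDim_of_levelsBelow` at `k + 1`, and the specialisation `n = 2m ≤ 2k`).
[cite: BrosnanFangNiePearlstein2009, §6 Lemma 48] -/
theorem levelsLE_iff_hodgeBelowDim (k : ℕ) :
    (∀ m : ℕ, m ≤ k → ∀ ⦃X : SchemeOver ℂ⦄, IsSmoothProjective (2 * m) X →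
      ∀ c : complexBetti X (2 * m), IsRationalClass c → IsOfHodgeType (2 * m) X (2 * m) m m c →
        c ∈ algebraicClasses X m) ↔ HodgeBelowDim (2 * (k + 1)) :=
  ⟨fun hlev ↦ hodgeBelowDim_of_levelsBelow (m := k + 1) fun m' hm' ↦ hlev m' (by omega),
    fun hB m hm _ hX c hc hh ↦ hB (by omega) hX m c hc hh⟩

/-! ### Classes of coniveau defect `≤ k` are algebraic, given codimension `≤ k` everywhere -/

/-- **Rational Hodge classes of coniveau defect `≤ k` are algebraic, given the Hodge conjecture in
codimension `≤ k` in every dimension.** On a smooth projective complex `n`-fold `X`, let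
`c ∈ H^{2(r+k)}(X(ℂ); ℂ)` be rational of Hodge type `(r+k, r+k)` and supported in codimension `≥ r`
(`c ∈ Nʳ H^{2(r+k)} = supportedClasses X (2(r+k)) r`). Then `c ∈ algebraicClasses X (r + k)`:
`c` dies off one closed `Z` all of whose points have codimension `≥ r`; `Z = ⋃ⱼ gⱼ(Ỹⱼ)` with `Ỹⱼ`
smooth projective of dimension `mⱼ ≤ n − r` (components + Hironaka,
`exists_family_iUnion_range_eq_of_isClosed`); Deligne (Hodge III Cor. 8.2.8) and the lifting of
Hodge classes (Voisin 2025 Cor. 2.12) — both DISCHARGED in the tree — write `c = Σⱼ (gⱼ)_* βⱼ` with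
`βⱼ` rational of type `(dⱼ, dⱼ)`, `dⱼ = r + k − (n − mⱼ) ≤ k`; the `βⱼ` are algebraic by hypothesis
and Gysin images of algebraic classes are algebraic (`complexGysin_mem_algebraicClasses`). The slice
`k = 1` is Voisin 2013 Lemma 2.1. [cite: Voisin2013GHCBloch, Lemma 2.1 (proof)]
[cite: DeligneHodgeIII1974, Cor. 8.2.8] [cite: Voisin2025, Cor. 2.12, Thm. 4.4 and Cor. 4.5]
[cite: Kollar2007, Thm. 3.27] -/
theorem mem_algebraicClasses_of_supportedClasses_of_codim_le (k : ℕ)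
    (hk : ∀ (n : ℕ) ⦃X : SchemeOver ℂ⦄, IsSmoothProjective n X → ∀ p : ℕ, p ≤ k →
      ∀ c : complexBetti X (2 * p), IsRationalClass c → IsOfHodgeType n X (2 * p) p p c →
        c ∈ algebraicClasses X p)
    {n : ℕ} {X : SchemeOver ℂ} (hX : IsSmoothProjective n X) (r : ℕ)
    {c : complexBetti X (2 * (r + k))} (hc : IsRationalClass c)
    (hh : IsOfHodgeType n X (2 * (r + k)) (r + k) (r + k) c)
    (hsupp : c ∈ supportedClasses X (2 * (r + k)) r) : c ∈ algebraicClasses X (r + k) := by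
  let μ : OrientationFamily := fun _ _ hY ↦ (Motives.ComplexPoints.isOrientableOver ℂ hY).some
  have hμ : μ.HasPoincareDuality := OrientationFamily.hasPoincareDuality μ
  have hS := gysinMap_restrictCompl_eq_zero_of_field.{0, 0} ℂ
  -- one closed `Z` of codimension `≥ r` off which `c` dies
  obtain ⟨Z, hZ, hZr, hcZ⟩ := exists_isClosed_of_mem_supportedClasses hsupp
  -- `Z = ⋃ⱼ gⱼ(Ỹⱼ)` with `dim Ỹⱼ + r ≤ n`
  obtain ⟨ι, hι, m, Y, hY, g, hZeq, hm⟩ := exists_family_iUnion_range_eq_of_isClosed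
    Literature.AlgebraicGeometry.Resolution.Hironaka1964_projective_holds hX hZ hZr
  haveI := hι
  -- Deligne descent + lifting: `c ∈ Σⱼ (gⱼ)_* span{rational (dⱼ,dⱼ)-classes}`
  have h4 := Voisin2025_hodgeClass_lift_complexGysin.mem_iSup_map_of_restrictCompl_eq_zero
    Deligne1974_ker_restrictCompl_eq_iSup_range_complexGysin_holds
    Voisin2025_hodgeClass_lift_complexGysin_holds μ hμ hX hY g hZeq hc hh hcZ
  refine SetLike.le_def.mp ?_ h4
  refine iSup_le fun j ↦ iSup_le fun d ↦ iSup_le fun hd ↦ ?_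
  rw [Submodule.map_le_iff_le_comap, Submodule.span_le]
  rintro β ⟨hβ, hβ'⟩
  rw [SetLike.mem_coe, Submodule.mem_comap]
  have hmj := hm j
  exact complexGysin_mem_algebraicClasses hS μ hμ (hY j) hX (g j) (by omega) hd
    (hk (m j) (hY j) d (by omega) β hβ hβ')

/-- **The rungs `≤ k` decide the classes of coniveau defect `≤ k` in every dimension**: granted the
middle rungs `(2m; m, m)` for `m ≤ k`, on every smooth projective complex variety every rational
`(r+k, r+k)`-class supported in codimension `≥ r` is algebraic (`hodge_codim_le_of_levelsLE` +
`mem_algebraicClasses_of_supportedClasses_of_codim_le`). [cite: Voisin2013GHCBloch, Lemma 2.1 (proof)]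
[cite: BrosnanFangNiePearlstein2009, §6 Lemma 48] -/
theorem mem_algebraicClasses_of_supportedClasses_of_levelsLE (k : ℕ)
    (hlev : ∀ m : ℕ, m ≤ k → ∀ ⦃X : SchemeOver ℂ⦄, IsSmoothProjective (2 * m) X →
      ∀ c : complexBetti X (2 * m), IsRationalClass c → IsOfHodgeType (2 * m) X (2 * m) m m c →
        c ∈ algebraicClasses X m)
    {n : ℕ} {X : SchemeOver ℂ} (hX : IsSmoothProjective n X) (r : ℕ)
    {c : complexBetti X (2 * (r + k))} (hc : IsRationalClass c)
    (hh : IsOfHodgeType n X (2 * (r + k)) (r + k) (r + k) c)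
    (hsupp : c ∈ supportedClasses X (2 * (r + k)) r) : c ∈ algebraicClasses X (r + k) :=
  mem_algebraicClasses_of_supportedClasses_of_codim_le k (hodge_codim_le_of_levelsLE k hlev)
    hX r hc hh hsupp

/-! ### `k = 2`: what HC(4;2,2) decides -/

/-- **Granted HC(4;2,2), on every smooth projective complex variety every rational Hodge class of
codimension `r + 2` supported in codimension `≥ r` (coniveau defect `≤ 2`) is algebraic** — the
slice `k = 2` of `mem_algebraicClasses_of_supportedClasses_of_codim_le`, fed with
`hodge_codim_le_two_of_hc42` (HC(4;2,2) ⟹ HC in codimension `≤ 2` everywhere). Voisin 2013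
Lemma 2.1 is the unconditional slice `k = 1`. [cite: Voisin2013GHCBloch, Lemma 2.1 (proof)]
[cite: DeligneHodgeIII1974, Cor. 8.2.8] [cite: Voisin2025, Cor. 2.12] -/
theorem mem_algebraicClasses_of_supportedClasses_of_hc42
    (h42 : ∀ ⦃X : SchemeOver ℂ⦄, IsSmoothProjective 4 X → ∀ c : complexBetti X (2 * 2),
      IsRationalClass c → IsOfHodgeType 4 X (2 * 2) 2 2 c → c ∈ algebraicClasses X 2)
    {n : ℕ} {X : SchemeOver ℂ} (hX : IsSmoothProjective n X) (r : ℕ)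
    {c : complexBetti X (2 * (r + 2))} (hc : IsRationalClass c)
    (hh : IsOfHodgeType n X (2 * (r + 2)) (r + 2) (r + 2) c)
    (hsupp : c ∈ supportedClasses X (2 * (r + 2)) r) : c ∈ algebraicClasses X (r + 2) :=
  mem_algebraicClasses_of_supportedClasses_of_codim_le 2 (hodge_codim_le_two_of_hc42 h42)
    hX r hc hh hsupp

/-- **Granted HC(4;2,2), in the middle degree of a smooth projective complex `2(m+2)`-fold every
rational `(m+2, m+2)`-class of coniveau `≥ m` is algebraic** — sixfolds (`m = 1`): coniveau `≥ 1`;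
eightfolds (`m = 2`): coniveau `≥ 2`; … — with no lower rung and no induction: the window
criterion of the crux's idea cards (a middle Hodge class detected by correspondences into
fourfolds dies off a closed subset of codimension `m`, and HC(4;2,2) evaluates the descended
`(2,2)`-classes on the `(m+4)`-dimensional supports). What stays open of rung `m + 2` is the
coniveau-defect `≥ 3` part. [cite: Voisin2013GHCBloch, Lemma 2.1 (proof)]
[cite: DeligneHodgeIII1974, Cor. 8.2.8] [cite: Voisin2025, Cor. 2.12] -/
theorem middle_mem_algebraicClasses_of_coniveau_of_hc42
    (h42 : ∀ ⦃X : SchemeOver ℂ⦄, IsSmoothProjective 4 X → ∀ c : complexBetti X (2 * 2),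
      IsRationalClass c → IsOfHodgeType 4 X (2 * 2) 2 2 c → c ∈ algebraicClasses X 2)
    {m : ℕ} {X : SchemeOver ℂ} (hX : IsSmoothProjective (2 * (m + 2)) X)
    {c : complexBetti X (2 * (m + 2))} (hc : IsRationalClass c)
    (hh : IsOfHodgeType (2 * (m + 2)) X (2 * (m + 2)) (m + 2) (m + 2) c)
    (hsupp : c ∈ supportedClasses X (2 * (m + 2)) m) : c ∈ algebraicClasses X (m + 2) :=
  mem_algebraicClasses_of_supportedClasses_of_hc42 h42 hX m hc hh hsupp

/-- **Granted HC(4;2,2), a rational `(3,3)`-class of coniveau `≥ 1` on a smooth projective complex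
SIXFOLD is algebraic** (the `m = 1` window; equivalently Deligne descent + HC in dimension `≤ 5`
from HC(4;2,2)): the heart of the crux at its first rung is exactly "rational `(3,3)`-classes on
CH₀-non-degenerate sixfolds have coniveau `≥ 1`". [cite: DeligneHodgeIII1974, Cor. 8.2.8]
[cite: Voisin2025, Cor. 2.12] -/
theorem sixfold_middle_mem_algebraicClasses_of_coniveau_one_of_hc42
    (h42 : ∀ ⦃X : SchemeOver ℂ⦄, IsSmoothProjective 4 X → ∀ c : complexBetti X (2 * 2),
      IsRationalClass c → IsOfHodgeType 4 X (2 * 2) 2 2 c → c ∈ algebraicClasses X 2)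
    {X : SchemeOver ℂ} (hX : IsSmoothProjective 6 X) {c : complexBetti X (2 * 3)}
    (hc : IsRationalClass c) (hh : IsOfHodgeType 6 X (2 * 3) 3 3 c)
    (hsupp : c ∈ supportedClasses X (2 * 3) 1) : c ∈ algebraicClasses X 3 :=
  middle_mem_algebraicClasses_of_coniveau_of_hc42 h42 (m := 1) hX hc hh hsupp

/-- **Registered form** (arrow form, one line; registered on item stmt-HodgeConjecture-14600 via
`ledger workitem stub-add` as the sub-goal this file lands): granted HC(4;2,2), on every smooth
projective complex variety every rational Hodge class of codimension `r + 2` supported in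
codimension `≥ r` is algebraic — `mem_algebraicClasses_of_supportedClasses_of_hc42` restated.
[cite: Voisin2013GHCBloch, Lemma 2.1 (proof)] [cite: DeligneHodgeIII1974, Cor. 8.2.8] -/
theorem hc42_imp_coniveauDefectTwo_algebraic :
    (∀ ⦃X : Literature.AlgebraicGeometry.Motives.SchemeOver ℂ⦄, Literature.AlgebraicGeometry.Motives.IsSmoothProjective 4 X → ∀ c : Literature.AlgebraicGeometry.HodgeTheory.complexBetti X (2 * 2), Literature.AlgebraicGeometry.HodgeTheory.IsRationalClass c → Literature.AlgebraicGeometry.HodgeTheory.IsOfHodgeType 4 X (2 * 2) 2 2 c → c ∈ Literature.AlgebraicGeometry.HodgeTheory.algebraicClasses X 2) → ∀ ⦃n : ℕ⦄ ⦃X : Literature.AlgebraicGeometry.Motives.SchemeOver ℂ⦄, Literature.AlgebraicGeometry.Motives.IsSmoothProjective n X → ∀ (r : ℕ) (c : Literature.AlgebraicGeometry.HodgeTheory.complexBetti X (2 * (r + 2))), Literature.AlgebraicGeometry.HodgeTheory.IsRationalClass c → Literature.AlgebraicGeometry.HodgeTheory.IsOfHodgeType n X (2 * (r + 2)) (r +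 2) (r + 2) c → c ∈ Literature.AlgebraicGeometry.HodgeTheory.supportedClasses X (2 * (r + 2)) r → c ∈ Literature.AlgebraicGeometry.HodgeTheory.algebraicClasses X (r + 2) :=
  fun h42 _ _ hX r _ hc hh hsupp ↦ mem_algebraicClasses_of_supportedClasses_of_hc42 h42 hX r hc hh hsupp

/-! ### The crux IS "coniveau defect ≤ 2", granted HC(4;2,2) -/

/-- **`SummitGrantedFourfolds` ↔ granted HC(4;2,2), every rational Hodge class has coniveau defect
`≤ 2`** (registered sub-goal): the crux (`HC(4;2,2) → HodgeConjecture`) is EQUIVALENT to "granted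
HC(4;2,2), on every smooth projective complex variety every rational `(r+2, r+2)`-class lies in
`Nʳ H^{2(r+2)}` (is supported in codimension `≥ r`)". (→): an algebraic class of codimension `r + 2`
has coniveau `r + 2 ≥ r` (`supportedClasses_mono`). (←): codimension `≤ 1` is points / Lefschetz
`(1,1)` (inside `hodge_codim_le_two_of_hc42`), and a class of codimension `r + 2` with coniveau `≥ r`
is algebraic granted HC(4;2,2) (`mem_algebraicClasses_of_supportedClasses_of_hc42`); Hodge models
exist unconditionally. Compare Voisin 2013 Lemma 2.1 (defect `≤ 1` is algebraic unconditionally):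
the crux is precisely the passage from defect `≤ 2` to defect `0` bought by the fourfold case.
[cite: Voisin2013GHCBloch, Lemma 2.1 (proof)] [cite: GrothendieckTopology1969, §1] [cite: Deligne2000, §1] -/
theorem summitGrantedFourfolds_iff_coniveauDefectTwo :
    Summit.HodgeConjecture.HodgeConjecture.Theses.NoetherLefschetzOneUp.SummitGrantedFourfolds ↔ ((∀ ⦃X : Literature.AlgebraicGeometry.Motives.SchemeOver ℂ⦄, Literature.AlgebraicGeometry.Motives.IsSmoothProjective 4 X → ∀ c : Literature.AlgebraicGeometry.HodgeTheory.complexBetti X (2 * 2), Literature.AlgebraicGeometry.HodgeTheory.IsRationalClass c → Literature.AlgebraicGeometry.HodgeTheory.IsOfHodgeType 4 X (2 * 2) 2 2 c → c ∈ Literature.AlgebraicGeometry.HodgeTheory.algebraicClasses X 2) → ∀ ⦃n : ℕ⦄ ⦃X : Literature.AlgebraicGeometry.Motives.SchemeOver ℂ⦄, Literature.AlgebraicGeometry.Motives.IsSmoothProjective n X → ∀ (r : ℕ) (c : Literature.AlgebraicGeometry.HodgeTheory.complexBetti X (2 * (r + 2))), Literature.AlgebraicGeometry.HodgeTheory.IsRationalClass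 c → Literature.AlgebraicGeometry.HodgeTheory.IsOfHodgeType n X (2 * (r + 2)) (r + 2) (r + 2) c → c ∈ Literature.AlgebraicGeometry.HodgeTheory.supportedClasses X (2 * (r + 2)) r) := by
  constructor
  · intro hS h42 n X hX r c hc hh
    exact supportedClasses_mono X (2 * (r + 2)) (show r ≤ r + 2 by omega) ((hS h42 hX).2 (r + 2) c hc hh)
  · intro hN
    unfold Summit.HodgeConjecture.HodgeConjecture.Theses.NoetherLefschetzOneUp.SummitGrantedFourfolds
    intro h42 n X hX
    refine ⟨(nonempty_hodgeModel_holds (n := n) (X := X)).nonempty hX, fun p c hc hh ↦ ?_⟩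
    rcases Nat.lt_or_ge p 2 with hp | hp
    · exact hodge_codim_le_two_of_hc42 h42 n hX p (by omega) c hc hh
    · obtain ⟨r, rfl⟩ : ∃ r, p = r + 2 := ⟨p - 2, by omega⟩
      exact mem_algebraicClasses_of_supportedClasses_of_hc42 h42 hX r hc hh (hN h42 hX r c hc hh)

end Summit.HodgeConjecture.HodgeConjecture.Theorems

end
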